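import Literature.MathematicalPhysics.QuantumLattice.ParticleHoleVariationalPressure
import Literature.MathematicalPhysics.QuantumLattice.HubbardTTPrimeSourcedParticleHole
import HarnessLib

/-!
# The particle–hole identity of the `t–t'` Hubbard pressure on `ℤ²`:
# `P(β; t, t', U, μ, h) = P(β; t, −t', U, U − μ, −h) + β(2μ − U)` for every real `β` and every `U`

`ParticleHoleVariationalPressure` proves the pressure identity for the nearest-neighbour Hubbard model in every dimension. On the square lattice
with next-nearest-neighbour hopping `t'` the two ends of a diagonal bond carry the same stagger, so the staggered particle–hole automorphism
REVERSES the diagonal hopping (`phAut_diagHoppingΦ_pair`, tree): the grand-canonical interaction `gcInteractionTT' t t' U μ h = Φ^{t,t',U} − μ n − h s`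
is carried to `Φ^{t,−t',U} − (U − μ) n + h s` plus the constant `(U − 2μ)·𝟙` per site (`particleHole_gcInteractionTT'`), and the variational
(= thermodynamic-limit, `FermionGibbsVariationalPrinciple`) pressure satisfies
**`P(β; t, t', U, μ, h) = P(β; t, −t', U, U − μ, −h) + β(2μ − U)`** for EVERY real `β` and every real `U` (`varPressure_gcInteractionTT'_particleHole`;
the tree's `gcPressureTT'Zeeman_particleHole` is the torus-limit version under its hypotheses). Translation-invariant equilibrium states at
`(t', μ, h)` are carried to those at `(−t', U − μ, −h)` with density `2 − ρ` (`IsVarEquilibrium.particleHole_gcInteractionTT'`, in the sequel file on states).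

Everything is PROVED; no definition, no named fact, no number.

## Tree / Mathlib search

REUSED: `gcInteractionTT'(_isHermitian/_isEven/_isTranslationInvariant/_hasFiniteRange)` (`TIVariationalPressure`, `FermionGibbsVariationalPrinciple`);
`hubbardTTPrimeFermionInteraction_apply`, `diagHoppingFermionInteraction_apply_singleton/_apply_pair_unitVec/_apply_eq_zero`, `hubbardFermionInteraction_apply_pair_diagVec`,
`self_ne_add_diagVec` (`HubbardNNNHoppingInteraction`); `phAut_hubbardΦ_singleton/_pair`, `phAut_diagHoppingΦ_pair` (`…ParticleHoleHubbardEnergy`, `HubbardTTPrimeSourcedParticleHole`);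
`FermionInteraction.particleHole`, `varPressure_particleHole`, `onSiteUnit`, `varPressure_pencil_onSiteUnit` (`ParticleHoleVariationalPressure`).

## References

* E. H. Lieb, Phys. Rev. Lett. 62 (1989) 1201, proof of Theorem 2.
* F. H. L. Essler et al., *The One-Dimensional Hubbard Model* (2005), §2.2.4.
* R. B. Israel, *Convexity in the Theory of Lattice Gases* (1979), Thm. I.2.4.
-/

noncomputable section

open scoped ComplexOrder BigOperators
open Finset Filter Topology

namespace Literature.MathematicalPhysics.QuantumLattice

open Matrix HubbardWave0 Literature.Probability.LatticeModels ThermodynamicLimit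

/-- **The particle–hole image of the grand-canonical `t–t'` interaction**:
`(Φ^{t,t',U} − μ n − h s)^α = (Φ^{t,−t',U} − (U − μ) n + h s) + (U − 2μ)·𝟙`. [cite: LiebPRL1989, proof of Theorem 2] [cite: EsslerEtAl2005, §2.2.4] -/
theorem particleHole_gcInteractionTT' (t t' U μ hz : ℝ) :
    (gcInteractionTT' t t' U μ hz).particleHole = (gcInteractionTT' t (-t') U (U - μ) (-hz)).pencil (onSiteUnit 2) (U - 2 * μ) := by
  refine FermionInteraction.ext fun X => ?_
  rw [FermionInteraction.particleHole_apply, FermionInteraction.pencil_apply, gcInteractionTT', gcInteractionTT', FermionInteraction.linearFamily_apply,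
    FermionInteraction.linearFamily_apply, Fin.sum_univ_two, Fin.sum_univ_two, hubbardTTPrimeFermionInteraction_apply, hubbardTTPrimeFermionInteraction_apply]
  simp only [Matrix.cons_val_zero, Matrix.cons_val_one]
  by_cases h1 : ∃ x : Site 2, X = {x}
  · obtain ⟨x, rfl⟩ := h1
    simp only [diagHoppingFermionInteraction_apply_singleton, add_zero, onSiteUnit_apply_singleton, numberInteraction_apply_singleton,
      spinImbalanceInteraction_apply_singleton, map_add, map_smul, map_sub, phAut_hubbardΦ_singleton, phAut_nAt, Complex.ofReal_neg, Complex.ofReal_sub,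
      Complex.ofReal_mul, Complex.ofReal_ofNat, neg_neg]
    module
  by_cases h2 : ∃ (x : Site 2) (i : Fin 2), X = {x, x + unitVec i}
  · obtain ⟨x, i, rfl⟩ := h2
    have hne : ∀ z : Site 2, ({x, x + unitVec i} : Finset (Site 2)) ≠ {z} := fun z hz => h1 ⟨z, hz⟩
    simp only [diagHoppingFermionInteraction_apply_pair_unitVec, add_zero, numberInteraction_apply_eq_zero hne, spinImbalanceInteraction_apply_eq_zero hne,
      onSiteUnit_apply_eq_zero hne, smul_zero, phAut_hubbardΦ_pair]
  by_cases h3 : ∃ (x : Site 2) (s : Fin 2), X = {x, x + diagVec s}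
  · obtain ⟨x, s, rfl⟩ := h3
    have hne : ∀ z : Site 2, ({x, x + diagVec s} : Finset (Site 2)) ≠ {z} := fun z hz => h1 ⟨z, hz⟩
    simp only [hubbardFermionInteraction_apply_pair_diagVec, zero_add, add_zero, numberInteraction_apply_eq_zero hne,
      spinImbalanceInteraction_apply_eq_zero hne, onSiteUnit_apply_eq_zero hne, smul_zero, phAut_diagHoppingΦ_pair]
  · push Not at h1 h2 h3
    rw [hubbardFermionInteraction_apply_eq_zero t U h1 (fun y i => h2 y i), diagHoppingFermionInteraction_apply_eq_zero _ (fun y s => h3 y s),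
      diagHoppingFermionInteraction_apply_eq_zero _ (fun y s => h3 y s), numberInteraction_apply_eq_zero h1, spinImbalanceInteraction_apply_eq_zero h1,
      onSiteUnit_apply_eq_zero h1]
    simp

/-- **THE PARTICLE–HOLE IDENTITY OF THE `t–t'` PRESSURE**: for every real `β`, `t`, `t'`, `U`, `μ`, `h` and `R ≥ 1`,
`P(β; t, t', U, μ, h) = P(β; t, −t', U, U − μ, −h) + β(2μ − U)`. [cite: LiebPRL1989, proof of Theorem 2] [cite: Israel1979, Thm. I.2.4] -/
theorem varPressure_gcInteractionTT'_particleHole (t t' U μ hz β : ℝ) {R : ℝ} (hR : 1 ≤ R) :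
    (gcInteractionTT' t t' U μ hz).varPressure β R = (gcInteractionTT' t (-t') U (U - μ) (-hz)).varPressure β R + β * (2 * μ - U) := by
  have hRR : (gcInteractionTT' t t' U μ hz).HasFiniteRange R := fun X hX => gcInteractionTT'_hasFiniteRange t t' U μ hz X (lt_of_le_of_lt hR hX)
  rw [← FermionInteraction.varPressure_particleHole two_pos (gcInteractionTT'_isHermitian t t' U μ hz) (gcInteractionTT'_isEven t t' U μ hz)
    (gcInteractionTT'_isTranslationInvariant t t' U μ hz) hRR β, particleHole_gcInteractionTT', FermionInteraction.varPressure_pencil_onSiteUnit]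
  ring

/-- **At `t' = 0`, `μ = U/2`, `h = 0` the `t–t'` interaction is self-dual**: `Ψ^α = Ψ + 0·𝟙 = Ψ`. [cite: LiebPRL1989, proof of Theorem 2] -/
theorem particleHole_gcInteractionTT'_halfFilling (t U : ℝ) :
    (gcInteractionTT' t 0 U (U / 2) 0).particleHole = gcInteractionTT' t 0 U (U / 2) 0 := by
  rw [particleHole_gcInteractionTT']
  refine FermionInteraction.ext fun X => ?_
  rw [FermionInteraction.pencil_apply, neg_zero, show U - U / 2 = U / 2 by ring, show U - 2 * (U / 2) = 0 by ring, Complex.ofReal_zero,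
    zero_smul, add_zero]

end Literature.MathematicalPhysics.QuantumLattice

end
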